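import Summits.BirchSwinnertonDyer.BirchSwinnertonDyer.Theorems.GenusKolyvaginAtTwoGenusPrimitiveSupplyAtTwoTowerComponents

/-!
# Route `GenusKolyvaginAtTwo`, crux `GenusPrimitiveSupplyAtTwo` (stmt-BirchSwinnertonDyer-22136), line `genus-supply`:
# the MULTI-PRIME NORM RELATION along the ring class tower — `Tr_{K[n]/K[m]} y(n) = (∏_{ℓ ∣ n/m} a_ℓ) · y(m)′` in `E(K[n])`

Lead prover seat bsd-line-gk2-p1 (g3). Gross 1991 Prop. 3.7 (1) («`Tr_ℓ y_n = a_ℓ y_{n/ℓ}`») ITERATED: for `n = m·t` square-free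
with every prime factor inert in `K` and prime to `N_E`, and `G` enumerating `𝒢_n = Gal(K[n]/K)`,
  `Σ_{g ∈ G, g ∈ Gal(K[n]/K[m])} g·y(n) = (∏_{ℓ ∣ t} a_ℓ) · (y(m) read in E(K[n]))`.
The tree had the one-prime step only (`HeegnerTrace.finsum_mem_ringClassGalOver_eq_frobeniusTrace_smul`, in `E(ℂ)`). Induction on the
number of prime factors of `t`, peeling one prime at the BOTTOM of the tower (`m ↦ mℓ`): the sum over `Gal(K[n]/K[m])` decomposes
along the restriction `res : 𝒢_n → Aut(K[mℓ])` (x11b3 `RingClassTower`) into translates of the sum over `Gal(K[n]/K[mℓ])`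
(`…LevelOneTower` §1 / abstract fibre lemma below), the inner sum is the induction hypothesis, and the outer sum is the one-prime
relation at level `mℓ`, pulled back from `E(ℂ)` by injectivity. All inclusions go through the abstract-subfield device.
This is the algebraic input that reads the genus-character components at level `n` as `Y_M^{(n)} = A(n/m)·Y_m′`
(`…TowerComponents` §3 + this file). Helper (`--supports stmt-BirchSwinnertonDyer-22136`); BSD is not proved by any of this.
-/

set_option linter.dupNamespace false -- tree convention: `Summit.BirchSwinnertonDyer.BirchSwinnertonDyer.Theorems` (summit = sub-problem)

noncomputable section

open scoped Classical

namespace Summit.BirchSwinnertonDyer.BirchSwinnertonDyer.Theorems.GenusKoly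

open Finset NumberField WeierstrassCurve Literature.NumberTheory.EllipticCurves
  Literature.NumberTheory.EllipticCurves.ModularForms Summit.BirchSwinnertonDyer.Rank1Residual.X11b

/-! ## §1 Abstract pieces -/

section Abstract

variable {W : WeierstrassCurve ℚ} {L : Type*} [Field L] [CharZero L] {S T U : Subfield L}

/-- Composition of inclusions of abstract subfields on points: `(P′)′ = P′`. [folklore] -/
theorem map_inclusion_map_inclusion_eq (hST : S ≤ T) (hTU : T ≤ U) (P : (W.baseChange S).toAffine.Point) :
    WeierstrassCurve.Affine.Point.map (W' := W) (Subfield.inclusion hTU).toRatAlgHom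
        (WeierstrassCurve.Affine.Point.map (W' := W) (Subfield.inclusion hST).toRatAlgHom P) =
      WeierstrassCurve.Affine.Point.map (W' := W) (Subfield.inclusion (hST.trans hTU)).toRatAlgHom P := by
  have hcomp : ((Subfield.inclusion hTU).toRatAlgHom).comp (Subfield.inclusion hST).toRatAlgHom =
      (Subfield.inclusion (hST.trans hTU)).toRatAlgHom := AlgHom.ext fun _ ↦ rfl
  rw [WeierstrassCurve.Affine.Point.map_map, hcomp]

end Abstract

section Fibre

variable {𝒢 ℋ : Type*} [Group 𝒢] [Group ℋ] {A : Type*} [AddCommGroup A]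

/-- **Orbit sum over a subgroup = sum over the image of translates of the orbit sum over the kernel** (weight-free form of
`…TowerComponents.sum_weight_restrict_eq_sum_fibres`): for `S ≤ 𝒢` enumerated by `G`, `r : S → ℋ`, `H` containing `r(S)`, a section
`lift` of `r` over `H` with values in `S`: `Σ_{g∈G} g·P = Σ_{t∈H} (lift t)·(Σ_{k ∈ G, r k = 1} k·P)`. [folklore] -/
theorem sum_act_eq_sum_fibres (act : 𝒢 →* AddMonoid.End A) (S : Subgroup 𝒢) (r : S →* ℋ) (G : Finset 𝒢)
    (hG : ∀ g, g ∈ G ↔ g ∈ S) (H : Finset ℋ) (hH : ∀ g (hg : g ∈ S), g ∈ G → r ⟨g, hg⟩ ∈ H)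
    (lift : ℋ → 𝒢) (hliftS : ∀ t ∈ H, lift t ∈ S) (hlift : ∀ t (ht : t ∈ H), r ⟨lift t, hliftS t ht⟩ = t) (P : A) :
    ∑ g ∈ G, act g P =
      ∑ t ∈ H, act (lift t) (∑ k ∈ G.filter (fun k ↦ (if hk : k ∈ S then r ⟨k, hk⟩ else 1) = 1), act k P) := by
  rw [← Finset.sum_fiberwise_of_maps_to (s := G) (t := H) (g := fun g ↦ if hg : g ∈ S then r ⟨g, hg⟩ else 1)
    (fun g hgG ↦ by rw [dif_pos ((hG g).mp hgG)]; exact hH g ((hG g).mp hgG) hgG)]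
  refine Finset.sum_congr rfl fun t ht ↦ ?_
  have hfilt : G.filter (fun g ↦ (if hg : g ∈ S then r ⟨g, hg⟩ else 1) = t) =
      G.filter (fun g ↦ (if hg : g ∈ S then r ⟨g, hg⟩ else 1) = r ⟨lift t, hliftS t ht⟩) :=
    Finset.filter_congr fun g _ ↦ by rw [hlift t ht]
  rw [hfilt]
  exact sum_filter_fibre_eq_act_sum_ker act S r G hG (hliftS t ht) P

end Fibre

/-! ## §2 The Heegner frame -/

section Heegner

variable {W : WeierstrassCurve ℚ} [NeZero (W.conductorNorm ℤ)] {K : Type} [Field K] [NumberField K]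
  {Dt : ModularParametrizationData W (W.conductorNorm ℤ)} {β : ℤ} {ι : K →+* ℂ}

omit [NeZero (W.conductorNorm ℤ)] in
/-- `Gal(K[n]/K[n]) = 1`: an automorphism fixing every element of `K[n]` lying in `K[n]` is the identity. [folklore] -/
theorem heegner_mem_ringClassGalOver_self_iff {n : ℕ} (g : ringClassField K ι n ≃ₐ[ℚ] ringClassField K ι n) :
    g ∈ ringClassGalOver ι n n ↔ g = 1 := by
  rw [ringClassGalOver, _root_.mem_fixingSubgroup_iff]
  constructor
  · intro h
    ext x
    exact congrArg Subtype.val (h x x.2)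
  · rintro rfl x _
    exact one_smul _ x

omit [NeZero (W.conductorNorm ℤ)] in
/-- `Gal(K[n]/K[m′]) ≤ Gal(K[n]/K[m])` when `K[m] ⊆ K[m′]`. [folklore] -/
theorem heegner_ringClassGalOver_antitone {n m m' : ℕ} (h : ringClassField K ι m ≤ ringClassField K ι m') :
    ringClassGalOver ι n m' ≤ ringClassGalOver ι n m := by
  intro g hg
  rw [ringClassGalOver, _root_.mem_fixingSubgroup_iff] at hg ⊢
  exact fun x hx ↦ hg x (h hx)

omit [NeZero (W.conductorNorm ℤ)] in
/-- In an enumeration `G` of `𝒢_n`, the elements of `Gal(K[n]/K[n])` are exactly `{1}`. [folklore] -/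
theorem heegner_filter_mem_ringClassGalOver_self {n : ℕ} (G : Finset (ringClassField K ι n ≃ₐ[ℚ] ringClassField K ι n))
    (hG : ∀ g, g ∈ G ↔ g ∈ ringClassGal ι n) : G.filter (fun g ↦ g ∈ ringClassGalOver ι n n) = {1} := by
  ext g
  rw [Finset.mem_filter, Finset.mem_singleton, heegner_mem_ringClassGalOver_self_iff]
  exact ⟨fun h ↦ h.2, fun h ↦ ⟨(hG g).mpr (h ▸ one_mem _), h⟩⟩

/-- **The one-prime norm relation `Tr_{K[ℓm]/K[m]} y(ℓm) = a_ℓ · y(m)′` in `E(K[ℓm])`** (Gross 1991 Prop. 3.7 (1); the tree's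
`HeegnerTrace.finsum_mem_ringClassGalOver_eq_frobeniusTrace_smul`, read back from `E(ℂ)` by injectivity), for any finite `H`
enumerating `Gal(K[ℓm]/K[m])`, a point `y′ ∈ E(K[ℓm])` over `x(ℓm)` and a point `y ∈ E(K[m])` over `x(m)`.
[cite: GrossLMS1991, §3 Prop. 3.7 (1)] -/
theorem heegner_sum_ringClassGalOver_eq_frobeniusTrace_smul_map [W.IsElliptic] [W.IsGloballyMinimal]
    (hK : IsImaginaryQuadratic K) (hD : NumberField.discr K < -4) (hH : SatisfiesHeegnerHypothesis (W.conductorNorm ℤ) K)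
    (hβ : (4 * (W.conductorNorm ℤ : ℕ) : ℤ) ∣ β ^ 2 - NumberField.discr K)
    {ℓ m m' : ℕ} (hℓ : ℓ.Prime) (hinert : (Ideal.span {(ℓ : 𝓞 K)}).IsPrime) (hℓN : ¬ ℓ ∣ W.conductorNorm ℤ)
    (hℓm : ¬ ℓ ∣ m) (hm : m ≠ 0) (hNm : Nat.Coprime (W.conductorNorm ℤ) m) (hmul : ℓ * m = m')
    (H : Finset (ringClassField K ι m' ≃ₐ[ℚ] ringClassField K ι m')) (hHm : ∀ t, t ∈ H ↔ t ∈ ringClassGalOver ι m' m)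
    {y' : (W.baseChange (ringClassField K ι m')).toAffine.Point}
    (hy' : WeierstrassCurve.Affine.Point.map (W' := W) (ringClassField K ι m').subtype.toRatAlgHom y' =
      heegnerPointComplexOfConductor Dt (NumberField.discr K) β m')
    {y : (W.baseChange (ringClassField K ι m)).toAffine.Point}
    (hy : WeierstrassCurve.Affine.Point.map (W' := W) (ringClassField K ι m).subtype.toRatAlgHom y =
      heegnerPointComplexOfConductor Dt (NumberField.discr K) β m)
    (hle : ringClassField K ι m ≤ ringClassField K ι m') :
    ∑ t ∈ H, pointGalHom W (ringClassField K ι m') t y' =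
      (W.frobeniusTrace ℓ) • WeierstrassCurve.Affine.Point.map (W' := W) (Subfield.inclusion hle).toRatAlgHom y := by
  have hND : IsCoprime (W.conductorNorm ℤ : ℤ) (NumberField.discr K) := by
    have h := Literature.SatisfiesHeegnerHypothesis.coprime_discr hK.1 hH
    refine Int.isCoprime_iff_gcd_eq_one.mpr ?_
    rw [Int.gcd_eq_natAbs, Int.natAbs_natCast]
    exact h
  have htr := HeegnerTrace.finsum_mem_ringClassGalOver_eq_frobeniusTrace_smul hK ι Dt hND hβ hℓ hinert hℓN hℓm hm hNm
    (Or.inr hD) hmul hy'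
  have hset : (ringClassGalOver ι m' m : Set (ringClassField K ι m' ≃ₐ[ℚ] ringClassField K ι m')) = ↑H :=
    Set.ext fun t ↦ by rw [SetLike.mem_coe, Finset.mem_coe, hHm]
  rw [hset, finsum_mem_coe_finset] at htr
  apply WeierstrassCurve.Affine.Point.map_injective (W' := W) (ringClassField K ι m').subtype.toRatAlgHom
  rw [map_sum, htr, map_zsmul, map_subtype_map_inclusion_eq hle W y, hy]

/-- **THE MULTI-PRIME NORM RELATION.** For `W` globally minimal, `K` imaginary quadratic with `d_K < −4` and the Heegner hypothesis,
`n` square-free all of whose prime factors are inert in `K` and prime to `N_E`, a datum `d` of conductor `n`, `G` enumerating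
`𝒢_n = Gal(K[n]/K)`, and a factorisation `n = m·t`: for every point `y ∈ E(K[m])` over `x(m)`,
  `Σ_{g ∈ G, g ∈ Gal(K[n]/K[m])} g·y(n) = (∏_{ℓ ∣ t} a_ℓ) · y′` in `E(K[n])`
(`y′` = `y` read in `E(K[n])` along `K[m] ⊆ K[n]`). Induction on the number of prime factors of `t` (statement quantified for the
induction). [cite: GrossLMS1991, §3 Prop. 3.7 (1)] -/
theorem heegner_sum_ringClassGalOver_eq_prod_frobeniusTrace_smul_map [W.IsElliptic] [W.IsGloballyMinimal]
    (hK : IsImaginaryQuadratic K) (hD : NumberField.discr K < -4) (hH : SatisfiesHeegnerHypothesis (W.conductorNorm ℤ) K)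
    {n : ℕ} (hn : Squarefree n) (hinert : ∀ q ∈ n.primeFactors, (Ideal.span {(q : 𝓞 K)}).IsPrime)
    (hN : ∀ q ∈ n.primeFactors, ¬ q ∣ W.conductorNorm ℤ) (d : KolyvaginHeegnerData Dt β ι n)
    (G : Finset (ringClassField K ι n ≃ₐ[ℚ] ringClassField K ι n)) (hG : ∀ g, g ∈ G ↔ g ∈ ringClassGal ι n) :
    ∀ (k m t : ℕ), m * t = n → t.primeFactors.card = k →
      ∀ (y : (W.baseChange (ringClassField K ι m)).toAffine.Point),
        WeierstrassCurve.Affine.Point.map (W' := W) (ringClassField K ι m).subtype.toRatAlgHom y =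
          heegnerPointComplexOfConductor Dt (NumberField.discr K) β m →
        ∀ (hle : ringClassField K ι m ≤ ringClassField K ι n),
          ∑ g ∈ G.filter (fun g ↦ g ∈ ringClassGalOver ι n m), pointGalHom W (ringClassField K ι n) g d.y =
            (∏ ℓ ∈ t.primeFactors, W.frobeniusTrace ℓ) •
              WeierstrassCurve.Affine.Point.map (W' := W) (Subfield.inclusion hle).toRatAlgHom y := by
  have hn0 : n ≠ 0 := hn.ne_zero
  have hcopn : Nat.Coprime n (W.conductorNorm ℤ) :=
    Nat.coprime_of_dvd fun q hq hqn hqN ↦ hN q (Nat.mem_primeFactors.mpr ⟨hq, hqn, hn0⟩) hqN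
  intro k
  induction k with
  | zero =>
    intro m t hmt ht y hy hle
    -- `t = 1`, `m = n`: the sum is over `Gal(K[n]/K[n]) = 1`
    have ht1 : t = 1 := by
      rcases Nat.primeFactors_eq_empty.mp (Finset.card_eq_zero.mp ht) with h | h
      · exact absurd hmt (by rw [h, mul_zero]; exact fun h0 ↦ hn0 h0.symm)
      · exact h
    subst ht1
    rw [mul_one] at hmt
    subst hmt
    rw [heegner_filter_mem_ringClassGalOver_self _ hG, Finset.sum_singleton, map_one, Nat.primeFactors_one,
      Finset.prod_empty, one_smul]
    exact heegner_eq_of_map_eq ((map_subtype_map_inclusion_eq hle W y).trans hy) d.map_y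
  | succ k ih =>
    intro m t hmt ht y hy hle
    -- peel one prime `ℓ ∣ t`: `t = ℓ t'`, `m' = ℓ m`, `n = m' t'`
    obtain ⟨ℓ, hℓt⟩ : t.primeFactors.Nonempty := Finset.card_pos.mp (by omega)
    have hℓ : ℓ.Prime := Nat.prime_of_mem_primeFactors hℓt
    have ht0 : t ≠ 0 := fun h ↦ hn0 (by rw [← hmt, h, mul_zero])
    have hm0 : m ≠ 0 := fun h ↦ hn0 (by rw [← hmt, h, zero_mul])
    have hℓdt : ℓ ∣ t := Nat.dvd_of_mem_primeFactors hℓt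
    set t' := t / ℓ with ht'_def
    have htt' : ℓ * t' = t := Nat.mul_div_cancel' hℓdt
    have ht'0 : t' ≠ 0 := fun h ↦ ht0 (by rw [← htt', h, mul_zero])
    have htn : t ∣ n := Dvd.intro_left m hmt
    have hmn : m ∣ n := Dvd.intro t hmt
    have hℓn : ℓ ∈ n.primeFactors := Nat.primeFactors_mono htn hn0 hℓt
    have hsqt : Squarefree t := hn.squarefree_of_dvd htn
    have hℓt' : ¬ ℓ ∣ t' := fun h ↦ by
      have : ℓ * ℓ ∣ t := by rw [← htt']; exact Nat.mul_dvd_mul_left ℓ h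
      exact hℓ.not_isUnit (hsqt ℓ this)
    have hℓm : ¬ ℓ ∣ m := fun h ↦ by
      have : ℓ * ℓ ∣ n := by rw [← hmt, ← htt']; exact mul_dvd_mul h (dvd_mul_right ℓ t')
      exact hℓ.not_isUnit (hn ℓ this)
    set m' := ℓ * m with hm'_def
    have hm'0 : m' ≠ 0 := mul_ne_zero hℓ.ne_zero hm0
    have hm't' : m' * t' = n := by rw [hm'_def, mul_assoc, mul_left_comm, htt', hmt]
    have hm'n : m' ∣ n := Dvd.intro t' hm't'
    have hmm'd : m ∣ m' := Dvd.intro_left ℓ rfl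
    have hdisj : Disjoint ℓ.primeFactors t'.primeFactors :=
      Nat.Coprime.disjoint_primeFactors ((Nat.Prime.coprime_iff_not_dvd hℓ).mpr hℓt')
    have hcard : t'.primeFactors.card = k := by
      have ht2 : (ℓ * t').primeFactors.card = k + 1 := by rw [htt']; exact ht
      rw [Nat.primeFactors_mul hℓ.ne_zero ht'0, Finset.card_union_of_disjoint hdisj, hℓ.primeFactors,
        Finset.card_singleton] at ht2
      omega
    -- coprimality of the levels with `N`
    have hNm : Nat.Coprime (W.conductorNorm ℤ) m := (Nat.Coprime.coprime_dvd_left hmn hcopn).symm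
    have hNm' : Nat.Coprime (W.conductorNorm ℤ) m' := (Nat.Coprime.coprime_dvd_left hm'n hcopn).symm
    -- the tower `K[m] ⊆ K[m'] ⊆ K[n]`
    have hle' : ringClassField K ι m' ≤ ringClassField K ι n := ringClassField_mono hK ι hm'n hn0
    have hmm' : ringClassField K ι m ≤ ringClassField K ι m' := ringClassField_mono hK ι hmm'd hm'0
    -- `y(m') ∈ E(K[m'])`
    obtain ⟨y', hy'⟩ := phi_heegnerPointOfConductor_mem_range_map_ringClassField_holds (W.conductorNorm ℤ) W K hK hH Dt β ι
      m' d.dvd_sq_sub hm'0 hNm'.symm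
    -- induction hypothesis at `(m', t')`
    have hIH := ih m' t' hm't' hcard y' hy' hle'
    -- restriction `𝒢_n → Aut(K[m'])`, an enumeration of `Gal(K[m']/K[m])`, a section
    obtain ⟨res, hres⟩ := RingClassTower.exists_restrictHom hK ι hm'n hn0
    haveI : NumberField (ringClassField K ι m') := numberField_ringClassField hK ι hm'0
    set H : Finset (ringClassField K ι m' ≃ₐ[ℚ] ringClassField K ι m') :=
      Finset.univ.filter (fun t ↦ t ∈ ringClassGalOver ι m' m) with hH_def
    have hHm : ∀ t, t ∈ H ↔ t ∈ ringClassGalOver ι m' m := fun t ↦ by simp [hH_def]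
    have hSle : ringClassGalOver ι n m ≤ ringClassGal ι n := ringClassGalOver_le_ringClassGal ι n m
    have key : ∀ t : ringClassField K ι m' ≃ₐ[ℚ] ringClassField K ι m', ∃ g : ringClassField K ι n ≃ₐ[ℚ] ringClassField K ι n,
        t ∈ ringClassGalOver ι m' m → ∃ hg : g ∈ ringClassGalOver ι n m, res ⟨g, hSle hg⟩ = t := by
      intro t
      by_cases ht : t ∈ ringClassGalOver ι m' m
      · obtain ⟨g, hg, hgt⟩ := RingClassTower.exists_mem_ringClassGalOver_restrictHom_eq hK ι hm'n hn0 hres hmm' ht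
        exact ⟨g, fun _ ↦ ⟨hg, by rw [← hgt]⟩⟩
      · exact ⟨1, fun h ↦ absurd h ht⟩
    choose lift hlift using key
    have hliftS : ∀ t ∈ H, lift t ∈ ringClassGalOver ι n m := fun t ht ↦ (hlift t ((hHm t).mp ht)).1
    have hliftr : ∀ t (ht : t ∈ H), res ⟨lift t, hSle (hliftS t ht)⟩ = t := fun t ht ↦ (hlift t ((hHm t).mp ht)).2
    -- fibre decomposition of the sum over `Gal(K[n]/K[m])` along `res`
    set r : ringClassGalOver ι n m →* (ringClassField K ι m' ≃ₐ[ℚ] ringClassField K ι m') :=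
      res.comp (Subgroup.inclusion hSle) with hr_def
    have hr : ∀ g (hg : g ∈ ringClassGalOver ι n m), r ⟨g, hg⟩ = res ⟨g, hSle hg⟩ := fun g hg ↦ rfl
    have hGS : ∀ g, g ∈ G.filter (fun g ↦ g ∈ ringClassGalOver ι n m) ↔ g ∈ ringClassGalOver ι n m := fun g ↦ by
      rw [Finset.mem_filter]
      exact ⟨fun h ↦ h.2, fun h ↦ ⟨(hG g).mpr (hSle h), h⟩⟩
    have hdec := sum_act_eq_sum_fibres (pointGalHom W (ringClassField K ι n)) (ringClassGalOver ι n m) r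
      (G.filter (fun g ↦ g ∈ ringClassGalOver ι n m)) hGS H
      (fun g hg _ ↦ (hHm _).mpr (by rw [hr]; exact RingClassTower.restrictHom_mem_ringClassGalOver hK ι hm'n hn0 hres ⟨g, hSle hg⟩ hg))
      lift hliftS (fun t ht ↦ by rw [hr]; exact hliftr t ht) d.y
    -- the kernel of `r` inside the enumeration is `Gal(K[n]/K[m'])`
    have hker : (G.filter (fun g ↦ g ∈ ringClassGalOver ι n m)).filter
        (fun k ↦ (if hk : k ∈ ringClassGalOver ι n m then r ⟨k, hk⟩ else 1) = 1) =
        G.filter (fun g ↦ g ∈ ringClassGalOver ι n m') := by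
      ext k
      simp only [Finset.mem_filter]
      constructor
      · rintro ⟨⟨hkG, hkS⟩, hk1⟩
        rw [dif_pos hkS, hr] at hk1
        exact ⟨hkG, RingClassTower.mem_ringClassGalOver_of_restrictHom_mem ι hres le_rfl ⟨k, hSle hkS⟩
          (by rw [hk1]; exact one_mem _)⟩
      · rintro ⟨hkG, hk'⟩
        have hkS : k ∈ ringClassGalOver ι n m := heegner_ringClassGalOver_antitone hmm' hk'
        refine ⟨⟨hkG, hkS⟩, ?_⟩
        rw [dif_pos hkS, hr]
        exact RingClassTower.restrictHom_eq_one_of_mem hK ι hm'n hn0 hres ⟨k, hSle hkS⟩ hk'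
    rw [hker, hIH] at hdec
    rw [hdec]
    -- move the lifts through the inclusion `K[m'] ⊆ K[n]` and use the one-prime relation at level `m'`
    have hmove : ∀ t ∈ H, pointGalHom W (ringClassField K ι n) (lift t)
        ((∏ ℓ ∈ t'.primeFactors, W.frobeniusTrace ℓ) •
          WeierstrassCurve.Affine.Point.map (W' := W) (Subfield.inclusion hle').toRatAlgHom y') =
        (∏ ℓ ∈ t'.primeFactors, W.frobeniusTrace ℓ) •
          WeierstrassCurve.Affine.Point.map (W' := W) (Subfield.inclusion hle').toRatAlgHom
            (pointGalHom W (ringClassField K ι m') t y') := by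
      intro t ht
      have hv := pointGalHom_map_inclusion_eq_of_valueFormula (W := W) hle' hres ⟨lift t, hSle (hliftS t ht)⟩ y'
      rw [hliftr t ht] at hv
      rw [map_zsmul]
      exact congrArg _ hv
    rw [Finset.sum_congr rfl hmove, ← Finset.smul_sum, ← map_sum,
      heegner_sum_ringClassGalOver_eq_frobeniusTrace_smul_map hK hD hH d.dvd_sq_sub hℓ (hinert ℓ hℓn) (hN ℓ hℓn) hℓm hm0 hNm
        rfl H hHm hy' hy hmm',
      map_zsmul, smul_smul, map_inclusion_map_inclusion_eq hmm' hle' y]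
    congr 1
    rw [← htt', Nat.primeFactors_mul hℓ.ne_zero ht'0, hℓ.primeFactors, Finset.prod_union
      (Finset.disjoint_singleton_left.mpr (fun h ↦ hℓt' (Nat.dvd_of_mem_primeFactors h))), Finset.prod_singleton, mul_comm]

end Heegner

end Summit.BirchSwinnertonDyer.BirchSwinnertonDyer.Theorems.GenusKoly

end
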